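import Mathlib
import Summits.NavierStokesRegularity.NavierStokesRegularity.Theses.PlaneEnergyCeiling
import Summits.NavierStokesRegularity.NavierStokesRegularity.Theorems.PlaneEnergyCeilingPlanarEnergyAPrioriClosedSlab
import Summits.NavierStokesRegularity.NavierStokesRegularity.Theorems.PlaneEnergyCeilingPlanarEnergyAPrioriKernelLog
import Summits.NavierStokesRegularity.NavierStokesRegularity.Theorems.TypeICertificateLadderRungReynoldsOneH1Rate
import Summits.NavierStokesRegularity.NavierStokesRegularity.Theorems.CertifiedBlowupCertifiedBlowupAxisymBlowupStubStabilityOfStepTools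

/-!
# Route PlaneEnergyCeiling · crux `PlanarEnergyAPriori` — CALIBRATION OF THE HALF-POTENTIAL HYPOTHESIS

Helper file for the crux item stmt-NavierStokesRegularity-16855 (`PlanarEnergyAPriori`), landed
`--supports` that item. The dynamic planar ceiling (F2, `dynamicPlanarCeiling`) closes the crux BY
NAME from a bound on the enstrophy half-potential along every frame solution
(`planarEnergyAPriori_of_halfPotentialBound`):

  `W_u(t) = ∫₀ᵗ (t − s)^{-1/2} Z(s) ds ≤ W₀`  for all `t < T`,   `Z(s) = ∫ ‖Du(s)‖²`.

The strategist census (gen 1, A-S6) records ON PAPER that this closing hypothesis is NoBlowup in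
other clothes. This file makes that calibration a theorem of the tree:

* `ofReal_div_sqrt_le_of_not_hasSmoothExtensionPast` — Leray's `H¹` blow-up rate
  (`RungReynoldsOne.stub_h1BlowupRate`, Tao's lifespan constant) in the form
  `a (T − s)^{-1/2} ≤ 2E(u₀) + 3 Z(s)` on `[0,T)` whenever `u` has no classical extension past `T`;
* `exists_halfPotential_gt_of_not_hasSmoothExtensionPast` — hence `W_u(t)` is unbounded as `t ↑ T`
  (the kernel `∫₀ᵗ ds /((T−s)) = log (T/(T−t))` diverges, `lintegral_Ioc_inv_sub`);
* `halfPotential_le_of_hasSmoothExtensionPast` — conversely a classical extension past `T` bounds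
  `W_u` on `[0,T)` (Tao's `H^k` bounds on the closed slab `[0,T]`, `∫₀ᵗ (t−s)^{-1/2} ds = 2√t`);
* `hasSmoothExtensionPast_iff_halfPotential_bounded` (per solution) and
  `halfPotentialBound_iff_noBlowup` (the two route-level hypotheses): the hypothesis of
  `planarEnergyAPriori_of_halfPotentialBound` is EQUIVALENT to the hypothesis of
  `planarEnergyAPriori_of_noBlowup` (= NoBlowup, stmt-NavierStokesRegularity-0054).

So the F1/F2 programme reduces the crux to nothing weaker than the summit's a-priori half — a
kernel-checked census entry, protecting future seats from being asked to "prove the half-potential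
bound".

References: J. Leray, Acta Math. 63 (1934) §20; Robinson–Rodrigo–Sadowski 2016, Lemma 6.11 /
(8.2); T. Tao, Anal. PDE 6 (2013), Thm. 5.4, Cor. 11.1.
-/

noncomputable section

-- single-conjunct summit: `Summit.<Summit>.<Problem>` repeats the name by the D-0017 layout
set_option linter.dupNamespace false

namespace Summit.NavierStokesRegularity.NavierStokesRegularity.Theorems.PlanarEnergyAPriori

open MeasureTheory Set Filter Topology Function WithLp
open scoped ENNReal NNReal RealInnerProductSpace
open Literature.Analysis.FluidPDE

variable {ν T : ℝ} {u : ℝ → EuclideanSpace ℝ (Fin 3) → EuclideanSpace ℝ (Fin 3)}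
  {p : ℝ → EuclideanSpace ℝ (Fin 3) → ℝ}

/-! ### Elementary pieces -/

/-- The kernel identity `(√x)⁻¹ · (a/√x) = a · x⁻¹` for `0 ≤ x`. [folklore] -/
theorem inv_sqrt_mul_div_sqrt {a x : ℝ} (hx : 0 ≤ x) :
    (Real.sqrt x)⁻¹ * (a / Real.sqrt x) = a * x⁻¹ := by
  rw [inv_mul_eq_div, div_div, Real.mul_self_sqrt hx, div_eq_mul_inv]

/-- The divergent kernel: for `L`, `a > 0` and `t = T (1 − e^{−L/a})` one has `t ∈ [0,T)` and
`log (T/(T − t)) = L/a`. [folklore] -/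
theorem exists_time_log_eq {T L a : ℝ} (hT : 0 < T) (hL : 0 < L) (ha : 0 < a) :
    ∃ t ∈ Ico 0 T, Real.log (T / (T - t)) = L / a := by
  set δ : ℝ := Real.exp (-(L / a)) with hδ
  have hδ0 : 0 < δ := Real.exp_pos _
  have hδ1 : δ < 1 := by
    have h : Real.exp (-(L / a)) < Real.exp 0 := Real.exp_lt_exp.2 (by rw [neg_lt_zero]; positivity)
    rwa [Real.exp_zero] at h
  refine ⟨T * (1 - δ), ⟨by nlinarith, by nlinarith⟩, ?_⟩
  have h1 : T - T * (1 - δ) = T * δ := by ring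
  rw [h1, div_mul_eq_div_div, div_self hT.ne', one_div, Real.log_inv, hδ, Real.log_exp, neg_neg]

/-! ### Leray's `H¹` rate as a lower bound on the enstrophy -/

/-- **Leray's enstrophy rate before a time with no classical extension.** If a classical solution
of unforced Navier–Stokes on `[0,T)` (`ν, T > 0`), Leray–Hopf from its rapidly decaying datum, has
NO classical extension past `T`, then for some `a > 0` and every `s ∈ [0,T)`
`a (T − s)^{-1/2} ≤ 2E(u 0) + 3 ∫ ‖Du(s)‖²` (in `ℝ≥0∞`): Leray's `H¹` blow-up rate
`cν³ ≤ (‖u(s)‖₂² + ‖∇u(s)‖²_F)² (T − s)` (`RungReynoldsOne.stub_h1BlowupRate`, Tao's lifespan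
constant), the Leray–Hopf energy bound `‖u(s)‖₂² ≤ 2E(u 0)` and `|Du|²_F ≤ 3‖Du‖²`
(`stab_lintegral_frob_le_three_mul`); here
`a = √(cν³)`. [cite: RobinsonRodrigoSadowski2016, Lemma 6.11 and (8.2)] -/
theorem ofReal_div_sqrt_le_of_not_hasSmoothExtensionPast (hν : 0 < ν) (hT : 0 < T)
    (hcl : IsClassicalNSSolutionOn (Ico 0 T) ν 0 u p) (hLH : IsLerayHopfOn T ν 0 (u 0) u)
    (hdec : HasRapidSpatialDecay (u 0)) (hnot : ¬ HasSmoothExtensionPast ν 0 u T) :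
    ∃ a : ℝ, 0 < a ∧ ∀ s ∈ Ico 0 T,
      ENNReal.ofReal (a / Real.sqrt (T - s)) ≤
        ENNReal.ofReal (2 * VectorCalculus.kineticEnergy (u 0)) + 3 * ∫⁻ x, ‖fderiv ℝ (u s) x‖ₑ ^ 2 := by
  obtain ⟨c, hc, hrate⟩ := RungReynoldsOne.stub_h1BlowupRate
  refine ⟨Real.sqrt (c * ν ^ 3), Real.sqrt_pos.2 (by positivity), fun s hs => ?_⟩
  have h := hrate hν hT hcl hLH hdec hnot s hs
  set K : ℝ≥0∞ := ENNReal.ofReal (2 * VectorCalculus.kineticEnergy (u 0)) with hK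
  set G : ℝ≥0∞ := ∫⁻ x, ‖fderiv ℝ (u s) x‖ₑ ^ 2 with hG
  set X : ℝ≥0∞ := K + 3 * G with hX
  have hTs : 0 < T - s := sub_pos.2 hs.2
  -- `E(s) + G_F(s) ≤ K + 3 G`
  have hle : (∫⁻ x, ‖u s x‖ₑ ^ 2) + ∫⁻ x, ENNReal.ofReal (frobeniusNormSq (fderiv ℝ (u s) x)) ≤ X :=
    add_le_add (hLH.lintegral_enorm_sq_le hν.le ⟨hs.1, hs.2.le⟩)
      (CertifiedBlowupAxisymBlowup.CompactAmplification.stab_lintegral_frob_le_three_mul (u s))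
  have h2 : ENNReal.ofReal (c * ν ^ 3) ≤ X ^ 2 * ENNReal.ofReal (T - s) :=
    h.trans (by gcongr)
  rcases eq_or_ne X ⊤ with htop | hfin
  · rw [htop]; exact le_top
  -- finite case: real arithmetic
  set r : ℝ := X.toReal with hr
  have hr0 : 0 ≤ r := ENNReal.toReal_nonneg
  have hXr : X = ENNReal.ofReal r := (ENNReal.ofReal_toReal hfin).symm
  rw [hXr, ← ENNReal.ofReal_pow hr0, ← ENNReal.ofReal_mul (sq_nonneg _),
    ENNReal.ofReal_le_ofReal_iff (by positivity)] at h2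
  rw [hXr]
  refine ENNReal.ofReal_le_ofReal ?_
  rw [div_le_iff₀ (Real.sqrt_pos.2 hTs), ← Real.sqrt_sq hr0, ← Real.sqrt_mul (sq_nonneg _)]
  exact Real.sqrt_le_sqrt h2

/-! ### No extension ⇒ the half-potential is unbounded -/

/-- Measurability of the kernel `s ↦ (√(T − s))⁻¹` (as an `ℝ≥0∞`-valued function). [folklore] -/
theorem measurable_ofReal_inv_sqrt_sub (T : ℝ) :
    Measurable fun s : ℝ => ENNReal.ofReal ((Real.sqrt (T - s))⁻¹) :=
  ((Real.continuous_sqrt.comp (continuous_const.sub continuous_id)).measurable.inv).ennreal_ofReal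

/-- **No classical extension past `T` ⇒ the enstrophy half-potential is unbounded as `t ↑ T`.**
Under the hypotheses of `ofReal_div_sqrt_le_of_not_hasSmoothExtensionPast`, for every `W₀` there
is `t ∈ [0,T)` with `W₀ < ∫₀ᵗ (t − s)^{-1/2} ∫ ‖Du(s)‖² ds`. Proof: multiply Leray's rate
`a (T−s)^{-1/2} ≤ 2E₀ + 3Z(s)` by `(T−s)^{-1/2} ≤ (t−s)^{-1/2}` and integrate over `(0,t)`:
`a log (T/(T−t)) ≤ 2E₀ · 2√T + 3 W_u(t)`, and the left side is as large as we please
(`t = T(1 − e^{−L/a})`). [cite: RobinsonRodrigoSadowski2016, Lemma 6.11 and (8.2)] -/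
theorem exists_halfPotential_gt_of_not_hasSmoothExtensionPast (hν : 0 < ν) (hT : 0 < T)
    (hcl : IsClassicalNSSolutionOn (Ico 0 T) ν 0 u p) (hLH : IsLerayHopfOn T ν 0 (u 0) u)
    (hdec : HasRapidSpatialDecay (u 0)) (hnot : ¬ HasSmoothExtensionPast ν 0 u T) (W₀ : ℝ) :
    ∃ t ∈ Ico 0 T, ENNReal.ofReal W₀ <
      ∫⁻ s in Ioo 0 t, ENNReal.ofReal ((Real.sqrt (t - s))⁻¹) * ∫⁻ x, ‖fderiv ℝ (u s) x‖ₑ ^ 2 := by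
  obtain ⟨a, ha, hlow⟩ := ofReal_div_sqrt_le_of_not_hasSmoothExtensionPast hν hT hcl hLH hdec hnot
  set Kr : ℝ := 2 * VectorCalculus.kineticEnergy (u 0) with hKr
  have hKr0 : 0 ≤ Kr := mul_nonneg (by norm_num) (kineticEnergy_nonneg _)
  set K : ℝ≥0∞ := ENNReal.ofReal Kr with hK
  set G : ℝ → ℝ≥0∞ := fun s => ∫⁻ x, ‖fderiv ℝ (u s) x‖ₑ ^ 2 with hG
  set k : ℝ → ℝ≥0∞ := fun s => ENNReal.ofReal ((Real.sqrt (T - s))⁻¹) with hk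
  have hkm : Measurable k := measurable_ofReal_inv_sqrt_sub T
  -- the size of the left-hand side we want, and the time realising it
  set L : ℝ := 3 * max W₀ 0 + Kr * (2 * Real.sqrt T) + 3 with hL
  have hL0 : 0 < L := by
    have : 0 ≤ Kr * (2 * Real.sqrt T) := by positivity
    have : 0 ≤ max W₀ 0 := le_max_right _ _
    linarith
  obtain ⟨t, ht, hlog⟩ := exists_time_log_eq hT hL0 ha
  refine ⟨t, ht, ?_⟩
  have htT : t < T := ht.2
  -- (1) the log kernel: `ofReal a * ∫_{(0,t)} (T−s)⁻¹ = ofReal L`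
  have hlogint : ∫⁻ s in Ioo 0 t, ENNReal.ofReal (a * (T - s)⁻¹) = ENNReal.ofReal L := by
    have h1 : ∫⁻ s in Ioo 0 t, ENNReal.ofReal (a * (T - s)⁻¹) =
        ENNReal.ofReal a * ∫⁻ s in Ioo 0 t, ENNReal.ofReal ((T - s)⁻¹) := by
      rw [← lintegral_const_mul' _ _ ENNReal.ofReal_ne_top]
      refine lintegral_congr fun s => ?_
      rw [ENNReal.ofReal_mul ha.le]
    rw [h1, setLIntegral_congr Ioo_ae_eq_Ioc, lintegral_Ioc_inv_sub ht.1 htT, hlog,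
      ← ENNReal.ofReal_mul ha.le, mul_div_cancel₀ _ ha.ne']
  -- (2) pointwise on `(0,t)`: `ofReal (a (T−s)⁻¹) ≤ K k(s) + 3 (k(s) G(s))`
  have hpt : ∀ s ∈ Ioo 0 t, ENNReal.ofReal (a * (T - s)⁻¹) ≤ K * k s + 3 * (k s * G s) := by
    intro s hs
    have hsT : s ∈ Ico 0 T := ⟨hs.1.le, hs.2.trans htT⟩
    have hTs : 0 ≤ T - s := by linarith [hs.2]
    have h1 : ENNReal.ofReal (a * (T - s)⁻¹) = k s * ENNReal.ofReal (a / Real.sqrt (T - s)) := by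
      simp only [hk]
      rw [← ENNReal.ofReal_mul (inv_nonneg.2 (Real.sqrt_nonneg _)), inv_sqrt_mul_div_sqrt hTs]
    rw [h1]
    calc k s * ENNReal.ofReal (a / Real.sqrt (T - s)) ≤ k s * (K + 3 * G s) :=
          mul_le_mul' le_rfl (hlow s hsT)
      _ = K * k s + 3 * (k s * G s) := by ring
  -- (3) integrate over `(0,t)`
  have hint : ENNReal.ofReal L ≤ K * ENNReal.ofReal (2 * Real.sqrt T) +
      3 * ∫⁻ s in Ioo 0 t, ENNReal.ofReal ((Real.sqrt (t - s))⁻¹) * G s := by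
    have hkint : ∫⁻ s in Ioo 0 t, k s ≤ ENNReal.ofReal (2 * Real.sqrt T) := by
      calc ∫⁻ s in Ioo 0 t, k s ≤ ∫⁻ s in Ioo 0 T, k s :=
            lintegral_mono_set (Ioo_subset_Ioo_right htT.le)
        _ = ENNReal.ofReal (2 * Real.sqrt T) := by
            simp only [hk]
            rw [lintegral_Ioo_inv_sqrt_sub hT.le, sub_zero]
    have hkG : ∫⁻ s in Ioo 0 t, k s * G s ≤
        ∫⁻ s in Ioo 0 t, ENNReal.ofReal ((Real.sqrt (t - s))⁻¹) * G s := by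
      refine setLIntegral_mono' measurableSet_Ioo fun s hs => ?_
      have hks : (Real.sqrt (T - s))⁻¹ ≤ (Real.sqrt (t - s))⁻¹ :=
        inv_anti₀ (Real.sqrt_pos.2 (sub_pos.2 hs.2)) (Real.sqrt_le_sqrt (by linarith [htT]))
      exact mul_le_mul' (ENNReal.ofReal_le_ofReal hks) le_rfl
    calc ENNReal.ofReal L = ∫⁻ s in Ioo 0 t, ENNReal.ofReal (a * (T - s)⁻¹) := hlogint.symm
      _ ≤ ∫⁻ s in Ioo 0 t, (K * k s + 3 * (k s * G s)) := setLIntegral_mono' measurableSet_Ioo hpt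
      _ = (K * ∫⁻ s in Ioo 0 t, k s) + 3 * ∫⁻ s in Ioo 0 t, k s * G s := by
          rw [lintegral_add_left (hkm.const_mul K), lintegral_const_mul _ hkm,
            lintegral_const_mul' _ _ (by norm_num : (3 : ℝ≥0∞) ≠ ⊤)]
      _ ≤ K * ENNReal.ofReal (2 * Real.sqrt T) +
          3 * ∫⁻ s in Ioo 0 t, ENNReal.ofReal ((Real.sqrt (t - s))⁻¹) * G s :=
          add_le_add (mul_le_mul' le_rfl hkint) (mul_le_mul' le_rfl hkG)
  -- (4) conclude: if the half-potential were `≤ W₀` the left side `L` would be `≤ L − 3`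
  by_contra hle
  rw [not_lt] at hle
  have h3 : (3 : ℝ≥0∞) * ENNReal.ofReal W₀ ≤ ENNReal.ofReal (3 * max W₀ 0) := by
    rw [ENNReal.ofReal_mul (by norm_num : (0 : ℝ) ≤ 3), ENNReal.ofReal_ofNat]
    exact mul_le_mul' le_rfl (ENNReal.ofReal_le_ofReal (le_max_left _ _))
  have hfin : ENNReal.ofReal L ≤ ENNReal.ofReal (Kr * (2 * Real.sqrt T) + 3 * max W₀ 0) := by
    calc ENNReal.ofReal L ≤ K * ENNReal.ofReal (2 * Real.sqrt T) + 3 * ENNReal.ofReal W₀ := by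
          refine hint.trans ?_
          gcongr
      _ ≤ ENNReal.ofReal (Kr * (2 * Real.sqrt T)) + ENNReal.ofReal (3 * max W₀ 0) := by
          rw [hK, ← ENNReal.ofReal_mul hKr0]
          exact add_le_add le_rfl h3
      _ = ENNReal.ofReal (Kr * (2 * Real.sqrt T) + 3 * max W₀ 0) :=
          (ENNReal.ofReal_add (by positivity) (by positivity)).symm
  rw [ENNReal.ofReal_le_ofReal_iff (by positivity)] at hfin
  rw [hL] at hfin
  linarith

/-- **No classical extension past `T` ⇒ no half-potential bound** (negation form of
`exists_halfPotential_gt_of_not_hasSmoothExtensionPast`). [folklore] -/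
theorem not_halfPotential_bounded_of_not_hasSmoothExtensionPast (hν : 0 < ν) (hT : 0 < T)
    (hcl : IsClassicalNSSolutionOn (Ico 0 T) ν 0 u p) (hLH : IsLerayHopfOn T ν 0 (u 0) u)
    (hdec : HasRapidSpatialDecay (u 0)) (hnot : ¬ HasSmoothExtensionPast ν 0 u T) :
    ¬ ∃ W₀ : ℝ, ∀ t ∈ Ico 0 T,
      (∫⁻ s in Ioo 0 t, ENNReal.ofReal ((Real.sqrt (t - s))⁻¹) * ∫⁻ x, ‖fderiv ℝ (u s) x‖ₑ ^ 2) ≤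
        ENNReal.ofReal W₀ := by
  rintro ⟨W₀, hW₀⟩
  obtain ⟨t, ht, hlt⟩ :=
    exists_halfPotential_gt_of_not_hasSmoothExtensionPast hν hT hcl hLH hdec hnot W₀
  exact (lt_irrefl _) (hlt.trans_le (hW₀ t ht))

/-- **Half-potential bound ⇒ classical extension past `T`** (per solution; contrapositive of the
previous theorem). [cite: RobinsonRodrigoSadowski2016, Lemma 6.11 and (8.2)] -/
theorem hasSmoothExtensionPast_of_halfPotential_bounded (hν : 0 < ν) (hT : 0 < T)
    (hcl : IsClassicalNSSolutionOn (Ico 0 T) ν 0 u p) (hLH : IsLerayHopfOn T ν 0 (u 0) u)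
    (hdec : HasRapidSpatialDecay (u 0))
    (hW : ∃ W₀ : ℝ, ∀ t ∈ Ico 0 T,
      (∫⁻ s in Ioo 0 t, ENNReal.ofReal ((Real.sqrt (t - s))⁻¹) * ∫⁻ x, ‖fderiv ℝ (u s) x‖ₑ ^ 2) ≤
        ENNReal.ofReal W₀) :
    HasSmoothExtensionPast ν 0 u T := by
  by_contra hnot
  exact not_halfPotential_bounded_of_not_hasSmoothExtensionPast hν hT hcl hLH hdec hnot hW

/-! ### Extension ⇒ the half-potential is bounded -/

/-- **Classical extension past `T` ⇒ the enstrophy half-potential is bounded on `[0,T)`.**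
The extension is classical on the CLOSED slab `[0,T]` with energy bounded there (Leray–Hopf on
`[0,T)`, Fatou at `t = T`) and rapidly decaying datum, so Tao 2013 bounds `∫ ‖Du'(s)‖² ≤ C` on
`[0,T]` (`tao2011_hasBoundedSobolevNormsOn_holds`), and `W_u(t) ≤ C ∫₀ᵗ (t−s)^{-1/2} ds ≤ 2C√T`.
[cite: Tao2011, Cor. 11.1 + Cor. 4.3 + Thm. 5.4 (iv)] -/
theorem halfPotential_le_of_hasSmoothExtensionPast (hν : 0 < ν) (hT : 0 < T)
    (hcl : IsClassicalNSSolutionOn (Ico 0 T) ν 0 u p) (hLH : IsLerayHopfOn T ν 0 (u 0) u)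
    (hdec : HasRapidSpatialDecay (u 0)) (hext : HasSmoothExtensionPast ν 0 u T) :
    ∃ W₀ : ℝ, ∀ t ∈ Ico 0 T,
      (∫⁻ s in Ioo 0 t, ENNReal.ofReal ((Real.sqrt (t - s))⁻¹) * ∫⁻ x, ‖fderiv ℝ (u s) x‖ₑ ^ 2) ≤
        ENNReal.ofReal W₀ := by
  have _ := hcl
  obtain ⟨T', hTT', u', p', hcl', hagree⟩ := hext
  have hclT : IsClassicalNSSolutionOn (Icc 0 T) ν 0 u' p' :=
    hcl'.mono (Icc_subset_Ico_right hTT') (uniqueDiffOn_Icc hT)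
  set K : ℝ≥0∞ := ENNReal.ofReal (2 * VectorCalculus.kineticEnergy (u 0)) with hK
  have hE₀ : ∀ t ∈ Ico 0 T, ∫⁻ x, ‖u' t x‖ₑ ^ 2 ≤ K := fun t ht => by
    rw [hagree t ht]
    exact hLH.lintegral_enorm_sq_le hν.le ⟨ht.1, ht.2.le⟩
  have hET : ∫⁻ x, ‖u' T x‖ₑ ^ 2 ≤ K :=
    lintegral_enorm_sq_le_of_extension hcl'.smooth_velocity hT hTT' hE₀
  have hE : ∀ t ∈ Icc 0 T, ∫⁻ x, ‖u' t x‖ₑ ^ 2 ≤ K := fun t ht => by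
    rcases ht.2.eq_or_lt with h | h
    · rw [h]; exact hET
    · exact hE₀ t ⟨ht.1, h⟩
  have hE' : ∃ C : ℝ≥0, ∀ t ∈ Icc 0 T, ∫⁻ x, ‖u' t x‖ₑ ^ 2 ≤ C :=
    ⟨(2 * VectorCalculus.kineticEnergy (u 0)).toNNReal, hE⟩
  have hdec' : HasRapidSpatialDecay (u' 0) := by
    rw [hagree 0 ⟨le_rfl, hT⟩]
    exact hdec
  have hH : HasBoundedSobolevNormsOn (Icc 0 T) u' :=
    tao2011_hasBoundedSobolevNormsOn_holds hν hT hclT hE' hdec'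
  obtain ⟨C, hC⟩ := exists_lintegral_enorm_fderiv_sq_le_of_hasBoundedSobolevNormsOn hH
  refine ⟨2 * Real.sqrt T * C, fun t ht => ?_⟩
  have hGle : ∀ s ∈ Ioo 0 t, ∫⁻ x, ‖fderiv ℝ (u s) x‖ₑ ^ 2 ≤ C := fun s hs => by
    rw [← hagree s ⟨hs.1.le, hs.2.trans ht.2⟩]
    exact hC s ⟨hs.1.le, (hs.2.trans ht.2).le⟩
  calc (∫⁻ s in Ioo 0 t, ENNReal.ofReal ((Real.sqrt (t - s))⁻¹) * ∫⁻ x, ‖fderiv ℝ (u s) x‖ₑ ^ 2)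
      ≤ ∫⁻ s in Ioo 0 t, ENNReal.ofReal ((Real.sqrt (t - s))⁻¹) * C :=
        setLIntegral_mono' measurableSet_Ioo fun s hs => mul_le_mul' le_rfl (hGle s hs)
    _ = ENNReal.ofReal (2 * Real.sqrt t) * C := by
        rw [lintegral_mul_const _ (measurable_ofReal_inv_sqrt_sub t),
          lintegral_Ioo_inv_sqrt_sub ht.1, sub_zero]
    _ ≤ ENNReal.ofReal (2 * Real.sqrt T) * C := by
        gcongr
        exact ht.2.le
    _ = ENNReal.ofReal (2 * Real.sqrt T * C) := by
        rw [← ENNReal.ofReal_coe_nnreal, ← ENNReal.ofReal_mul (by positivity)]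

/-! ### The calibration -/

/-- **Per-solution calibration.** For a classical solution of unforced Navier–Stokes on `[0,T)`
(`ν, T > 0`), Leray–Hopf from its rapidly decaying datum: it extends classically past `T` iff its
enstrophy half-potential `∫₀ᵗ (t−s)^{-1/2} ∫ ‖Du(s)‖² ds` is bounded on `[0,T)`.
[cite: RobinsonRodrigoSadowski2016, Lemma 6.11 and (8.2)] -/
theorem hasSmoothExtensionPast_iff_halfPotential_bounded (hν : 0 < ν) (hT : 0 < T)
    (hcl : IsClassicalNSSolutionOn (Ico 0 T) ν 0 u p) (hLH : IsLerayHopfOn T ν 0 (u 0) u)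
    (hdec : HasRapidSpatialDecay (u 0)) :
    HasSmoothExtensionPast ν 0 u T ↔ ∃ W₀ : ℝ, ∀ t ∈ Ico 0 T,
      (∫⁻ s in Ioo 0 t, ENNReal.ofReal ((Real.sqrt (t - s))⁻¹) * ∫⁻ x, ‖fderiv ℝ (u s) x‖ₑ ^ 2) ≤
        ENNReal.ofReal W₀ :=
  ⟨halfPotential_le_of_hasSmoothExtensionPast hν hT hcl hLH hdec,
    hasSmoothExtensionPast_of_halfPotential_bounded hν hT hcl hLH hdec⟩

/-- **Route-level calibration (registered shape): the half-potential hypothesis IS NoBlowup.**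
The hypothesis of `planarEnergyAPriori_of_halfPotentialBound` (a half-potential bound along every
classical Leray–Hopf solution from rapidly decaying data) is equivalent to the hypothesis of
`planarEnergyAPriori_of_noBlowup` (every such solution extends classically past `T`, verbatim
NoBlowup = stmt-NavierStokesRegularity-0054). So the F1/F2 programme (flux variation bound +
dynamic planar ceiling) reduces the crux `PlanarEnergyAPriori` to nothing weaker than the summit's
a-priori half — strategist census gen 1, A-S6, now kernel-checked.
[cite: RobinsonRodrigoSadowski2016, Lemma 6.11 and (8.2)] -/
theorem halfPotentialBound_iff_noBlowup : (∀ (ν T : ℝ), 0 < ν → 0 < T → ∀ (u : ℝ → EuclideanSpace ℝ (Fin 3) → EuclideanSpace ℝ (Fin 3)) (p : ℝ → EuclideanSpace ℝ (Fin 3) → ℝ), Literature.Analysis.FluidPDE.IsClassicalNSSolutionOn (Set.Ico 0 T) ν 0 u p → Literature.Analysis.FluidPDE.IsLerayHopfOn T ν 0 (u 0) u → Literature.Analysis.FluidPDE.HasRapidSpatialDecay (u 0) → ∃ W₀ : ℝ, ∀ t ∈ Set.Ico 0 T, (∫⁻ s in Set.Ioo 0 t, ENNReal.ofReal ((Real.sqrt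 (t - s))⁻¹) * ∫⁻ x, ‖fderiv ℝ (u s) x‖ₑ ^ 2) ≤ ENNReal.ofReal W₀) ↔ (∀ (ν T : ℝ), 0 < ν → 0 < T → ∀ (u : ℝ → EuclideanSpace ℝ (Fin 3) → EuclideanSpace ℝ (Fin 3)) (p : ℝ → EuclideanSpace ℝ (Fin 3) → ℝ), Literature.Analysis.FluidPDE.IsClassicalNSSolutionOn (Set.Ico 0 T) ν 0 u p → Literature.Analysis.FluidPDE.IsLerayHopfOn T ν 0 (u 0) u → Literature.Analysis.FluidPDE.HasRapidSpatialDecay (u 0) → Literature.Analysis.FluidPDE.HasSmoothExtensionPast ν 0 u T) :=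
  ⟨fun h ν T hν hT u p hcl hLH hdec =>
      hasSmoothExtensionPast_of_halfPotential_bounded hν hT hcl hLH hdec (h ν T hν hT u p hcl hLH hdec),
    fun h ν T hν hT u p hcl hLH hdec =>
      halfPotential_le_of_hasSmoothExtensionPast hν hT hcl hLH hdec (h ν T hν hT u p hcl hLH hdec)⟩

end Summit.NavierStokesRegularity.NavierStokesRegularity.Theorems.PlanarEnergyAPriori

end
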